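import Summits.CriticalPhenomena.Ising3D.Control2DOpeEpsCells
import Summits.CriticalPhenomena.Ising3D.Control2DL15OpeEUBData25
import Summits.CriticalPhenomena.Ising3D.Control2DL15OpeEUBData26
import Summits.CriticalPhenomena.Ising3D.Control2DL15OpeEUBData27
import Summits.CriticalPhenomena.Ising3D.Control2DL15OpeEUBData28
import Summits.CriticalPhenomena.Ising3D.Control2DL15OpeEUBData29
import Summits.CriticalPhenomena.Ising3D.Control2DL15OpeEUBData30
import Summits.CriticalPhenomena.Ising3D.Control2DL15OpeEUBData31
import Summits.CriticalPhenomena.Ising3D.Control2DL15OpeEUBData32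
import Summits.CriticalPhenomena.Ising3D.Control2DL15OpeEUBRegion
import Summits.CriticalPhenomena.Ising3D.Control2DOpeEpsKernel
import Mathlib.Tactic.IntervalCases
import Mathlib.Tactic.Linarith
import Mathlib.Tactic.NormNum
import HarnessLib

/-!
# A kind-`ope2eps` (sense UPPER) 2D γ-certificate in the kernel: `W(box) < 319051/5000000` at `Δ_σ = 1/8` under `A2D′` (Λ = 15)
(cell `pub-ising3x`, seat controls-1 gen 21; KERNEL PATH for the 2D γ-certificates, kind `ope2eps` (the λ²_σσε datum) — CONTROL-ONLY)

HONEST FRAMING: lottery ticket; floor = tightest certified 3D Ising CFT bounds; no exact-solution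
claim without a proof. CONTROL-ONLY: `d = 2`, global blocks, `Δ_σ = 1/8` exact, the 2D axiom set `A2D′` with the
CERTIFIED `ε` box `[197/200, 20001/20000]` as scalar input; `W = Σ_(ℓ=0, Δ_i in the box) p_i 2^(-Δ_i)` is the weighted in-box scalar content
(`Control2DOpeEpsTwoSided`; `pBoxTwoSided_rb6_L15` turns the (lower, upper) pair into two-sided bounds on `p_box` and `λ²_σσ[box] = 2 p_box`).

**`opeEpsUpper_2d_L15_opeEUB : OpeEpsUpperA2D (1/8) 2 1 (197 / 200) (20001 / 20000) (319051/5000000)`** — from the RB-6 ope2eps (sense upper) certificate `j140872_functional_deriv2d_L15_E040_sig1o8_ope2epsupper_P319051o5000000.json` (Λ = 15, E₀ = 40): W(box) < 319051/5000000 at Δ_σ = 1/8 under A2D′, W = Σ_(ℓ=0, Δ ∈ [197/200, 20001/20000]) p_i 2^(-Δ_i) (⇒ λ²_σσ[box] < 2·2^(20001/20000)·319051/5000000), with EVERY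
obligation re-decided in the Lean kernel: per box cell (I″) and the SIGN of the truncated scalar block
as Bernstein decisions on the spin-0 literal (`epsChk*_opeEUB_l*`, `Control2DOpeEpsKernel`), (R) by `region_of_kernelCertAuto`, cells `cells_opeEUB`
(`OpeEpsCellsN`: (C′), the stress-tensor point, spin 2 on [3, E₀), even spins ≥ 4). Zero grant compute. No facts, standard axioms only.

`cells_opeEUB`: every cell obligation of the certificate ((E) on the ε box, (C′) scalars on [2, E₀), the stress-tensor point (T), spin 2 on [3, E₀), even spins ≥ 4 on [ℓ, E₀); E₀ = 40), in the witness form `∃ N ≥ E₀` with the spin's own truncation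
order, from the kernel-decided Bernstein leaves of `Control2DL15OpeEUBData*` via `cell_nonneg_of_bernCheck`. No facts, standard axioms only.

ONE MODULE for the cells theorem and the assembly (controls-1 g20): every gate dependency level waits for the farm's tree build to catch
up with the freshly landed imports (measured 1–2 h per level under load, `remote:stale:…:unbuilt`), so the cells theorem below is not a
separate `…Cells` module as in the earlier replays; statements and proofs are unchanged.
controls-1 g26: `cells_opeEUB` is a `have` inside `opeEpsUpper_2d_L15_opeEUB` (gate statement-dedup between the two senses' cells theorems); exported statements unchanged.
-/

namespace Summit.CriticalPhenomena.Ising3D.Control2D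

open Finset Set
open Literature.MathematicalPhysics.QuantumFieldTheory.ConformalBootstrap3D

-- controls-1 g26: `cells_opeEUB` is proved INLINE inside `opeEpsUpper_2d_L15_opeEUB` (`have`): as a top-level theorem its statement differs from the other
-- sense's cells theorem only by the weight table inside `fun p => (wt p : ℝ)`, which the gate's statement-dedup normaliser identifies (`dedup.landed`).
set_option maxHeartbeats 0 in
set_option maxRecDepth 200000 in
/-- **2D control, γ-architecture, kind `ope2eps` (UPPER sense), kernel-complete: under `A2D′` at `Δ_σ = 1/8` with the `ε` box
`[197/200, 20001/20000]`, `W(box) < 319051/5000000`**, every obligation of the Λ = 15 functional checked in the Lean kernel. CONTROL-ONLY (d = 2).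
[cite: RattazziEtAl2008, §5.5] -/
theorem opeEpsUpper_2d_L15_opeEUB : OpeEpsUpperA2D (1 / 8 : ℝ) 2 1 (197 / 200) (20001 / 20000) (319051 / 5000000) := by
  have cells_opeEUB : OpeEpsCellsN slL15.toFinset (fun p => (wtopeEUB p : ℝ)) (1 / 8) 2 1 40 := by
    refine ⟨?_, ?_, ?_, ?_⟩
    · intro Δ h1 h2
      replace h2 := h2.le
      refine ⟨55 + 1, by norm_num, ?_⟩
      rcases le_or_gt Δ ((83 : ℝ) / 32) with hd0 | hd0
      · exact cell_nonneg_of_bernAuto_trunc wtopeEUB slL15_nodup slL15_deg 0 55 358 (q := 64) (a := 64) (L := 19) (by norm_num) (by norm_num) (by norm_num) (by rw [phatopeEUBs0_eq]; exact cellChk_opeEUB_s0l0) (by norm_num; linarith) (by norm_num; linarith)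
      rcases le_or_gt Δ ((351 : ℝ) / 128) with hd1 | hd1
      · exact cell_nonneg_of_bernAuto_trunc wtopeEUB slL15_nodup slL15_deg 0 55 358 (q := 256) (a := 332) (L := 19) (by norm_num) (by norm_num) (by norm_num) (by rw [phatopeEUBs0_eq]; exact cellChk_opeEUB_s0l1) (by norm_num; linarith) (by norm_num; linarith)
      rcases le_or_gt Δ ((185 : ℝ) / 64) with hd2 | hd2
      · exact cell_nonneg_of_bernAuto_trunc wtopeEUB slL15_nodup slL15_deg 0 55 358 (q := 256) (a := 351) (L := 19) (by norm_num) (by norm_num) (by norm_num) (by rw [phatopeEUBs0_eq]; exact cellChk_opeEUB_s0l2) (by norm_num; linarith) (by norm_num; linarith)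
      rcases le_or_gt Δ ((51 : ℝ) / 16) with hd3 | hd3
      · exact cell_nonneg_of_bernAuto_trunc wtopeEUB slL15_nodup slL15_deg 0 55 358 (q := 128) (a := 185) (L := 19) (by norm_num) (by norm_num) (by norm_num) (by rw [phatopeEUBs0_eq]; exact cellChk_opeEUB_s0l3) (by norm_num; linarith) (by norm_num; linarith)
      rcases le_or_gt Δ ((35 : ℝ) / 8) with hd4 | hd4
      · exact cell_nonneg_of_bernAuto_trunc wtopeEUB slL15_nodup slL15_deg 0 55 358 (q := 32) (a := 51) (L := 19) (by norm_num) (by norm_num) (by norm_num) (by rw [phatopeEUBs0_eq]; exact cellChk_opeEUB_s0l4) (by norm_num; linarith) (by norm_num; linarith)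
      rcases le_or_gt Δ ((579 : ℝ) / 128) with hd5 | hd5
      · exact cell_nonneg_of_bernAuto_trunc wtopeEUB slL15_nodup slL15_deg 0 55 358 (q := 256) (a := 560) (L := 19) (by norm_num) (by norm_num) (by norm_num) (by rw [phatopeEUBs0_eq]; exact cellChk_opeEUB_s0l5) (by norm_num; linarith) (by norm_num; linarith)
      rcases le_or_gt Δ ((299 : ℝ) / 64) with hd6 | hd6
      · exact cell_nonneg_of_bernAuto_trunc wtopeEUB slL15_nodup slL15_deg 0 55 358 (q := 256) (a := 579) (L := 19) (by norm_num) (by norm_num) (by norm_num) (by rw [phatopeEUBs0_eq]; exact cellChk_opeEUB_s0l6) (by norm_num; linarith) (by norm_num; linarith)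
      rcases le_or_gt Δ ((159 : ℝ) / 32) with hd7 | hd7
      · exact cell_nonneg_of_bernAuto_trunc wtopeEUB slL15_nodup slL15_deg 0 55 358 (q := 128) (a := 299) (L := 19) (by norm_num) (by norm_num) (by norm_num) (by rw [phatopeEUBs0_eq]; exact cellChk_opeEUB_s0l7) (by norm_num; linarith) (by norm_num; linarith)
      rcases le_or_gt Δ ((89 : ℝ) / 16) with hd8 | hd8
      · exact cell_nonneg_of_bernAuto_trunc wtopeEUB slL15_nodup slL15_deg 0 55 358 (q := 64) (a := 159) (L := 19) (by norm_num) (by norm_num) (by norm_num) (by rw [phatopeEUBs0_eq]; exact cellChk_opeEUB_s0l8) (by norm_num; linarith) (by norm_num; linarith)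
      rcases le_or_gt Δ ((27 : ℝ) / 4) with hd9 | hd9
      · exact cell_nonneg_of_bernAuto_trunc wtopeEUB slL15_nodup slL15_deg 0 55 358 (q := 32) (a := 89) (L := 19) (by norm_num) (by norm_num) (by norm_num) (by rw [phatopeEUBs0_eq]; exact cellChk_opeEUB_s0l9) (by norm_num; linarith) (by norm_num; linarith)
      rcases le_or_gt Δ ((23 : ℝ) / 2) with hd10 | hd10
      · exact cell_nonneg_of_bernAuto_trunc wtopeEUB slL15_nodup slL15_deg 0 55 358 (q := 8) (a := 27) (L := 19) (by norm_num) (by norm_num) (by norm_num) (by rw [phatopeEUBs0_eq]; exact cellChk_opeEUB_s0l10) (by norm_num; linarith) (by norm_num; linarith)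
      rcases le_or_gt Δ (21 : ℝ) with hd11 | hd11
      · exact cell_nonneg_of_bernAuto_trunc wtopeEUB slL15_nodup slL15_deg 0 55 358 (q := 4) (a := 23) (L := 19) (by norm_num) (by norm_num) (by norm_num) (by rw [phatopeEUBs0_eq]; exact cellChk_opeEUB_s0l11) (by norm_num; linarith) (by norm_num; linarith)
      exact cell_nonneg_of_bernAuto_trunc wtopeEUB slL15_nodup slL15_deg 0 55 358 (q := 2) (a := 21) (L := 19) (by norm_num) (by norm_num) (by norm_num) (by rw [phatopeEUBs0_eq]; exact cellChk_opeEUB_s0l12) (by norm_num; linarith) (by norm_num; linarith)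
    · refine ⟨47 + 1, by norm_num, ?_⟩
      exact cell_nonneg_of_bernAuto_trunc wtopeEUB slL15_nodup slL15_deg 2 47 304 (q := 1) (a := 0) (L := 0) (by norm_num) (by norm_num) (by norm_num) (by rw [phatopeEUBs2_eq]; exact cellChk_opeEUB_s2l0) (by norm_num) (by norm_num)
    · intro Δ h1 h2
      replace h1 : (3 : ℝ) ≤ Δ := by linarith
      replace h2 := h2.le
      refine ⟨47 + 1, by norm_num, ?_⟩
      rcases le_or_gt Δ ((85 : ℝ) / 16) with hd0 | hd0
      · exact cell_nonneg_of_bernAuto_trunc wtopeEUB slL15_nodup slL15_deg 2 47 304 (q := 32) (a := 16) (L := 37) (by norm_num) (by norm_num) (by norm_num) (by rw [phatopeEUBs2_eq]; exact cellChk_opeEUB_s2l1) (by norm_num; linarith) (by norm_num; linarith)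
      rcases le_or_gt Δ ((377 : ℝ) / 64) with hd1 | hd1
      · exact cell_nonneg_of_bernAuto_trunc wtopeEUB slL15_nodup slL15_deg 2 47 304 (q := 128) (a := 212) (L := 37) (by norm_num) (by norm_num) (by norm_num) (by rw [phatopeEUBs2_eq]; exact cellChk_opeEUB_s2l2) (by norm_num; linarith) (by norm_num; linarith)
      rcases le_or_gt Δ ((1545 : ℝ) / 256) with hd2 | hd2
      · exact cell_nonneg_of_bernAuto_trunc wtopeEUB slL15_nodup slL15_deg 2 47 304 (q := 512) (a := 996) (L := 37) (by norm_num) (by norm_num) (by norm_num) (by rw [phatopeEUBs2_eq]; exact cellChk_opeEUB_s2l3) (by norm_num; linarith) (by norm_num; linarith)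
      rcases le_or_gt Δ ((791 : ℝ) / 128) with hd3 | hd3
      · exact cell_nonneg_of_bernAuto_trunc wtopeEUB slL15_nodup slL15_deg 2 47 304 (q := 512) (a := 1033) (L := 37) (by norm_num) (by norm_num) (by norm_num) (by rw [phatopeEUBs2_eq]; exact cellChk_opeEUB_s2l4) (by norm_num; linarith) (by norm_num; linarith)
      rcases le_or_gt Δ ((207 : ℝ) / 32) with hd4 | hd4
      · exact cell_nonneg_of_bernAuto_trunc wtopeEUB slL15_nodup slL15_deg 2 47 304 (q := 256) (a := 535) (L := 37) (by norm_num) (by norm_num) (by norm_num) (by rw [phatopeEUBs2_eq]; exact cellChk_opeEUB_s2l5) (by norm_num; linarith) (by norm_num; linarith)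
      rcases le_or_gt Δ ((61 : ℝ) / 8) with hd5 | hd5
      · exact cell_nonneg_of_bernAuto_trunc wtopeEUB slL15_nodup slL15_deg 2 47 304 (q := 64) (a := 143) (L := 37) (by norm_num) (by norm_num) (by norm_num) (by rw [phatopeEUBs2_eq]; exact cellChk_opeEUB_s2l6) (by norm_num; linarith) (by norm_num; linarith)
      rcases le_or_gt Δ ((49 : ℝ) / 4) with hd6 | hd6
      · exact cell_nonneg_of_bernAuto_trunc wtopeEUB slL15_nodup slL15_deg 2 47 304 (q := 16) (a := 45) (L := 37) (by norm_num) (by norm_num) (by norm_num) (by rw [phatopeEUBs2_eq]; exact cellChk_opeEUB_s2l7) (by norm_num; linarith) (by norm_num; linarith)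
      rcases le_or_gt Δ ((43 : ℝ) / 2) with hd7 | hd7
      · exact cell_nonneg_of_bernAuto_trunc wtopeEUB slL15_nodup slL15_deg 2 47 304 (q := 8) (a := 41) (L := 37) (by norm_num) (by norm_num) (by norm_num) (by rw [phatopeEUBs2_eq]; exact cellChk_opeEUB_s2l8) (by norm_num; linarith) (by norm_num; linarith)
      exact cell_nonneg_of_bernAuto_trunc wtopeEUB slL15_nodup slL15_deg 2 47 304 (q := 4) (a := 39) (L := 37) (by norm_num) (by norm_num) (by norm_num) (by rw [phatopeEUBs2_eq]; exact cellChk_opeEUB_s2l9) (by norm_num; linarith) (by norm_num; linarith)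
    · intro ℓ hℓ hℓ0 hℓ2 Δ hℓΔ hΔ
      have hℓR : (ℓ : ℝ) < 40 := lt_of_le_of_lt hℓΔ hΔ
      have hℓE : ℓ < 40 := by exact_mod_cast hℓR
      replace h2 := hΔ.le
      interval_cases ℓ
      · exact absurd rfl hℓ0
      · exact absurd hℓ (by decide)
      · exact absurd rfl hℓ2
      · exact absurd hℓ (by decide)
      · have h1 : (4 : ℝ) ≤ Δ := by exact_mod_cast hℓΔ
        refine ⟨47 + 1, by norm_num, ?_⟩
        rcases le_or_gt Δ ((41 : ℝ) / 8) with hd0 | hd0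
        · exact cell_nonneg_of_bernAuto_trunc wtopeEUB slL15_nodup slL15_deg 4 47 308 (q := 16) (a := 0) (L := 9) (by norm_num) (by norm_num) (by norm_num) (by rw [phatopeEUBs4_eq]; exact cellChk_opeEUB_s4l0) (by norm_num; linarith) (by norm_num; linarith)
        rcases le_or_gt Δ ((91 : ℝ) / 16) with hd1 | hd1
        · exact cell_nonneg_of_bernAuto_trunc wtopeEUB slL15_nodup slL15_deg 4 47 308 (q := 32) (a := 18) (L := 9) (by norm_num) (by norm_num) (by norm_num) (by rw [phatopeEUBs4_eq]; exact cellChk_opeEUB_s4l1) (by norm_num; linarith) (by norm_num; linarith)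
        rcases le_or_gt Δ ((25 : ℝ) / 4) with hd2 | hd2
        · exact cell_nonneg_of_bernAuto_trunc wtopeEUB slL15_nodup slL15_deg 4 47 308 (q := 32) (a := 27) (L := 9) (by norm_num) (by norm_num) (by norm_num) (by rw [phatopeEUBs4_eq]; exact cellChk_opeEUB_s4l2) (by norm_num; linarith) (by norm_num; linarith)
        rcases le_or_gt Δ ((17 : ℝ) / 2) with hd3 | hd3
        · exact cell_nonneg_of_bernAuto_trunc wtopeEUB slL15_nodup slL15_deg 4 47 308 (q := 8) (a := 9) (L := 9) (by norm_num) (by norm_num) (by norm_num) (by rw [phatopeEUBs4_eq]; exact cellChk_opeEUB_s4l3) (by norm_num; linarith) (by norm_num; linarith)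
        rcases le_or_gt Δ ((145 : ℝ) / 16) with hd4 | hd4
        · exact cell_nonneg_of_bernAuto_trunc wtopeEUB slL15_nodup slL15_deg 4 47 308 (q := 32) (a := 72) (L := 9) (by norm_num) (by norm_num) (by norm_num) (by rw [phatopeEUBs4_eq]; exact cellChk_opeEUB_s4l4) (by norm_num; linarith) (by norm_num; linarith)
        rcases le_or_gt Δ ((299 : ℝ) / 32) with hd5 | hd5
        · exact cell_nonneg_of_bernAuto_trunc wtopeEUB slL15_nodup slL15_deg 4 47 308 (q := 64) (a := 162) (L := 9) (by norm_num) (by norm_num) (by norm_num) (by rw [phatopeEUBs4_eq]; exact cellChk_opeEUB_s4l5) (by norm_num; linarith) (by norm_num; linarith)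
        rcases le_or_gt Δ ((77 : ℝ) / 8) with hd6 | hd6
        · exact cell_nonneg_of_bernAuto_trunc wtopeEUB slL15_nodup slL15_deg 4 47 308 (q := 64) (a := 171) (L := 9) (by norm_num) (by norm_num) (by norm_num) (by rw [phatopeEUBs4_eq]; exact cellChk_opeEUB_s4l6) (by norm_num; linarith) (by norm_num; linarith)
        rcases le_or_gt Δ ((43 : ℝ) / 4) with hd7 | hd7
        · exact cell_nonneg_of_bernAuto_trunc wtopeEUB slL15_nodup slL15_deg 4 47 308 (q := 16) (a := 45) (L := 9) (by norm_num) (by norm_num) (by norm_num) (by rw [phatopeEUBs4_eq]; exact cellChk_opeEUB_s4l7) (by norm_num; linarith) (by norm_num; linarith)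
        rcases le_or_gt Δ (13 : ℝ) with hd8 | hd8
        · exact cell_nonneg_of_bernAuto_trunc wtopeEUB slL15_nodup slL15_deg 4 47 308 (q := 8) (a := 27) (L := 9) (by norm_num) (by norm_num) (by norm_num) (by rw [phatopeEUBs4_eq]; exact cellChk_opeEUB_s4l8) (by norm_num; linarith) (by norm_num; linarith)
        rcases le_or_gt Δ (22 : ℝ) with hd9 | hd9
        · exact cell_nonneg_of_bernAuto_trunc wtopeEUB slL15_nodup slL15_deg 4 47 308 (q := 2) (a := 9) (L := 9) (by norm_num) (by norm_num) (by norm_num) (by rw [phatopeEUBs4_eq]; exact cellChk_opeEUB_s4l9) (by norm_num; linarith) (by norm_num; linarith)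
        exact cell_nonneg_of_bernAuto_trunc wtopeEUB slL15_nodup slL15_deg 4 47 308 (q := 1) (a := 9) (L := 9) (by norm_num) (by norm_num) (by norm_num) (by rw [phatopeEUBs4_eq]; exact cellChk_opeEUB_s4l10) (by norm_num; linarith) (by norm_num; linarith)
      · exact absurd hℓ (by decide)
      · have h1 : (6 : ℝ) ≤ Δ := by exact_mod_cast hℓΔ
        refine ⟨55 + 1, by norm_num, ?_⟩
        rcases le_or_gt Δ ((113 : ℝ) / 16) with hd0 | hd0
        · exact cell_nonneg_of_bernAuto_trunc wtopeEUB slL15_nodup slL15_deg 6 55 374 (q := 32) (a := 0) (L := 17) (by norm_num) (by norm_num) (by norm_num) (by rw [phatopeEUBs6_eq]; exact cellChk_opeEUB_s6l0) (by norm_num; linarith) (by norm_num; linarith)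
        rcases le_or_gt Δ ((65 : ℝ) / 8) with hd1 | hd1
        · exact cell_nonneg_of_bernAuto_trunc wtopeEUB slL15_nodup slL15_deg 6 55 374 (q := 32) (a := 17) (L := 17) (by norm_num) (by norm_num) (by norm_num) (by rw [phatopeEUBs6_eq]; exact cellChk_opeEUB_s6l1) (by norm_num; linarith) (by norm_num; linarith)
        rcases le_or_gt Δ ((41 : ℝ) / 4) with hd2 | hd2
        · exact cell_nonneg_of_bernAuto_trunc wtopeEUB slL15_nodup slL15_deg 6 55 374 (q := 16) (a := 17) (L := 17) (by norm_num) (by norm_num) (by norm_num) (by rw [phatopeEUBs6_eq]; exact cellChk_opeEUB_s6l2) (by norm_num; linarith) (by norm_num; linarith)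
        rcases le_or_gt Δ ((29 : ℝ) / 2) with hd3 | hd3
        · exact cell_nonneg_of_bernAuto_trunc wtopeEUB slL15_nodup slL15_deg 6 55 374 (q := 8) (a := 17) (L := 17) (by norm_num) (by norm_num) (by norm_num) (by rw [phatopeEUBs6_eq]; exact cellChk_opeEUB_s6l3) (by norm_num; linarith) (by norm_num; linarith)
        rcases le_or_gt Δ ((249 : ℝ) / 16) with hd4 | hd4
        · exact cell_nonneg_of_bernAuto_trunc wtopeEUB slL15_nodup slL15_deg 6 55 374 (q := 32) (a := 136) (L := 17) (by norm_num) (by norm_num) (by norm_num) (by rw [phatopeEUBs6_eq]; exact cellChk_opeEUB_s6l4) (by norm_num; linarith) (by norm_num; linarith)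
        rcases le_or_gt Δ ((515 : ℝ) / 32) with hd5 | hd5
        · exact cell_nonneg_of_bernAuto_trunc wtopeEUB slL15_nodup slL15_deg 6 55 374 (q := 64) (a := 306) (L := 17) (by norm_num) (by norm_num) (by norm_num) (by rw [phatopeEUBs6_eq]; exact cellChk_opeEUB_s6l5) (by norm_num; linarith) (by norm_num; linarith)
        rcases le_or_gt Δ ((133 : ℝ) / 8) with hd6 | hd6
        · exact cell_nonneg_of_bernAuto_trunc wtopeEUB slL15_nodup slL15_deg 6 55 364 (q := 64) (a := 323) (L := 17) (by norm_num) (by norm_num) (by norm_num) (by rw [phatopeEUBs6_eq]; exact cellChk_opeEUB_s6l6) (by norm_num; linarith) (by norm_num; linarith)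
        rcases le_or_gt Δ ((75 : ℝ) / 4) with hd7 | hd7
        · exact cell_nonneg_of_bernAuto_trunc wtopeEUB slL15_nodup slL15_deg 6 55 374 (q := 16) (a := 85) (L := 17) (by norm_num) (by norm_num) (by norm_num) (by rw [phatopeEUBs6_eq]; exact cellChk_opeEUB_s6l7) (by norm_num; linarith) (by norm_num; linarith)
        rcases le_or_gt Δ (23 : ℝ) with hd8 | hd8
        · exact cell_nonneg_of_bernAuto_trunc wtopeEUB slL15_nodup slL15_deg 6 55 374 (q := 8) (a := 51) (L := 17) (by norm_num) (by norm_num) (by norm_num) (by rw [phatopeEUBs6_eq]; exact cellChk_opeEUB_s6l8) (by norm_num; linarith) (by norm_num; linarith)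
        exact cell_nonneg_of_bernAuto_trunc wtopeEUB slL15_nodup slL15_deg 6 55 374 (q := 2) (a := 17) (L := 17) (by norm_num) (by norm_num) (by norm_num) (by rw [phatopeEUBs6_eq]; exact cellChk_opeEUB_s6l9) (by norm_num; linarith) (by norm_num; linarith)
      · exact absurd hℓ (by decide)
      · have h1 : (8 : ℝ) ≤ Δ := by exact_mod_cast hℓΔ
        refine ⟨39 + 1, by norm_num, ?_⟩
        exact cell_nonneg_of_bernAuto_trunc wtopeEUB slL15_nodup slL15_deg 8 39 259 (q := 1) (a := 0) (L := 16) (by norm_num) (by norm_num) (by norm_num) (by rw [phatopeEUBs8_eq]; exact cellChk_opeEUB_s8l0) (by norm_num; linarith) (by norm_num; linarith)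
      · exact absurd hℓ (by decide)
      · have h1 : (10 : ℝ) ≤ Δ := by exact_mod_cast hℓΔ
        refine ⟨39 + 1, by norm_num, ?_⟩
        rcases le_or_gt Δ ((35 : ℝ) / 2) with hd0 | hd0
        · exact cell_nonneg_of_bernAuto_trunc wtopeEUB slL15_nodup slL15_deg 10 39 262 (q := 4) (a := 0) (L := 15) (by norm_num) (by norm_num) (by norm_num) (by rw [phatopeEUBs10_eq]; exact cellChk_opeEUB_s10l0) (by norm_num; linarith) (by norm_num; linarith)
        rcases le_or_gt Δ (25 : ℝ) with hd1 | hd1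
        · exact cell_nonneg_of_bernAuto_trunc wtopeEUB slL15_nodup slL15_deg 10 39 262 (q := 4) (a := 15) (L := 15) (by norm_num) (by norm_num) (by norm_num) (by rw [phatopeEUBs10_eq]; exact cellChk_opeEUB_s10l1) (by norm_num; linarith) (by norm_num; linarith)
        exact cell_nonneg_of_bernAuto_trunc wtopeEUB slL15_nodup slL15_deg 10 39 262 (q := 2) (a := 15) (L := 15) (by norm_num) (by norm_num) (by norm_num) (by rw [phatopeEUBs10_eq]; exact cellChk_opeEUB_s10l2) (by norm_num; linarith) (by norm_num; linarith)
      · exact absurd hℓ (by decide)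
      · have h1 : (12 : ℝ) ≤ Δ := by exact_mod_cast hℓΔ
        refine ⟨39 + 1, by norm_num, ?_⟩
        rcases le_or_gt Δ ((55 : ℝ) / 4) with hd0 | hd0
        · exact cell_nonneg_of_bernAuto_trunc wtopeEUB slL15_nodup slL15_deg 12 39 264 (q := 8) (a := 0) (L := 7) (by norm_num) (by norm_num) (by norm_num) (by rw [phatopeEUBs12_eq]; exact cellChk_opeEUB_s12l0) (by norm_num; linarith) (by norm_num; linarith)
        rcases le_or_gt Δ ((31 : ℝ) / 2) with hd1 | hd1
        · exact cell_nonneg_of_bernAuto_trunc wtopeEUB slL15_nodup slL15_deg 12 39 264 (q := 8) (a := 7) (L := 7) (by norm_num) (by norm_num) (by norm_num) (by rw [phatopeEUBs12_eq]; exact cellChk_opeEUB_s12l1) (by norm_num; linarith) (by norm_num; linarith)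
        rcases le_or_gt Δ (19 : ℝ) with hd2 | hd2
        · exact cell_nonneg_of_bernAuto_trunc wtopeEUB slL15_nodup slL15_deg 12 39 264 (q := 4) (a := 7) (L := 7) (by norm_num) (by norm_num) (by norm_num) (by rw [phatopeEUBs12_eq]; exact cellChk_opeEUB_s12l2) (by norm_num; linarith) (by norm_num; linarith)
        rcases le_or_gt Δ (26 : ℝ) with hd3 | hd3
        · exact cell_nonneg_of_bernAuto_trunc wtopeEUB slL15_nodup slL15_deg 12 39 264 (q := 2) (a := 7) (L := 7) (by norm_num) (by norm_num) (by norm_num) (by rw [phatopeEUBs12_eq]; exact cellChk_opeEUB_s12l3) (by norm_num; linarith) (by norm_num; linarith)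
        exact cell_nonneg_of_bernAuto_trunc wtopeEUB slL15_nodup slL15_deg 12 39 264 (q := 1) (a := 7) (L := 7) (by norm_num) (by norm_num) (by norm_num) (by rw [phatopeEUBs12_eq]; exact cellChk_opeEUB_s12l4) (by norm_num; linarith) (by norm_num; linarith)
      · exact absurd hℓ (by decide)
      · have h1 : (14 : ℝ) ≤ Δ := by exact_mod_cast hℓΔ
        refine ⟨39 + 1, by norm_num, ?_⟩
        rcases le_or_gt Δ ((237 : ℝ) / 16) with hd0 | hd0
        · exact cell_nonneg_of_bernAuto_trunc wtopeEUB slL15_nodup slL15_deg 14 39 266 (q := 32) (a := 0) (L := 13) (by norm_num) (by norm_num) (by norm_num) (by rw [phatopeEUBs14_eq]; exact cellChk_opeEUB_s14l0) (by norm_num; linarith) (by norm_num; linarith)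
        rcases le_or_gt Δ ((125 : ℝ) / 8) with hd1 | hd1
        · exact cell_nonneg_of_bernAuto_trunc wtopeEUB slL15_nodup slL15_deg 14 39 266 (q := 32) (a := 13) (L := 13) (by norm_num) (by norm_num) (by norm_num) (by rw [phatopeEUBs14_eq]; exact cellChk_opeEUB_s14l1) (by norm_num; linarith) (by norm_num; linarith)
        rcases le_or_gt Δ ((69 : ℝ) / 4) with hd2 | hd2
        · exact cell_nonneg_of_bernAuto_trunc wtopeEUB slL15_nodup slL15_deg 14 39 266 (q := 16) (a := 13) (L := 13) (by norm_num) (by norm_num) (by norm_num) (by rw [phatopeEUBs14_eq]; exact cellChk_opeEUB_s14l2) (by norm_num; linarith) (by norm_num; linarith)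
        rcases le_or_gt Δ ((41 : ℝ) / 2) with hd3 | hd3
        · exact cell_nonneg_of_bernAuto_trunc wtopeEUB slL15_nodup slL15_deg 14 39 266 (q := 8) (a := 13) (L := 13) (by norm_num) (by norm_num) (by norm_num) (by rw [phatopeEUBs14_eq]; exact cellChk_opeEUB_s14l3) (by norm_num; linarith) (by norm_num; linarith)
        rcases le_or_gt Δ (27 : ℝ) with hd4 | hd4
        · exact cell_nonneg_of_bernAuto_trunc wtopeEUB slL15_nodup slL15_deg 14 39 266 (q := 4) (a := 13) (L := 13) (by norm_num) (by norm_num) (by norm_num) (by rw [phatopeEUBs14_eq]; exact cellChk_opeEUB_s14l4) (by norm_num; linarith) (by norm_num; linarith)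
        exact cell_nonneg_of_bernAuto_trunc wtopeEUB slL15_nodup slL15_deg 14 39 266 (q := 2) (a := 13) (L := 13) (by norm_num) (by norm_num) (by norm_num) (by rw [phatopeEUBs14_eq]; exact cellChk_opeEUB_s14l5) (by norm_num; linarith) (by norm_num; linarith)
      · exact absurd hℓ (by decide)
      · have h1 : (16 : ℝ) ≤ Δ := by exact_mod_cast hℓΔ
        refine ⟨39 + 1, by norm_num, ?_⟩
        rcases le_or_gt Δ (19 : ℝ) with hd0 | hd0
        · exact cell_nonneg_of_bernAuto_trunc wtopeEUB slL15_nodup slL15_deg 16 39 268 (q := 2) (a := 0) (L := 3) (by norm_num) (by norm_num) (by norm_num) (by rw [phatopeEUBs16_eq]; exact cellChk_opeEUB_s16l0) (by norm_num; linarith) (by norm_num; linarith)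
        rcases le_or_gt Δ (22 : ℝ) with hd1 | hd1
        · exact cell_nonneg_of_bernAuto_trunc wtopeEUB slL15_nodup slL15_deg 16 39 268 (q := 2) (a := 3) (L := 3) (by norm_num) (by norm_num) (by norm_num) (by rw [phatopeEUBs16_eq]; exact cellChk_opeEUB_s16l1) (by norm_num; linarith) (by norm_num; linarith)
        rcases le_or_gt Δ (28 : ℝ) with hd2 | hd2
        · exact cell_nonneg_of_bernAuto_trunc wtopeEUB slL15_nodup slL15_deg 16 39 268 (q := 1) (a := 3) (L := 3) (by norm_num) (by norm_num) (by norm_num) (by rw [phatopeEUBs16_eq]; exact cellChk_opeEUB_s16l2) (by norm_num; linarith) (by norm_num; linarith)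
        exact cell_nonneg_of_bernAuto_trunc wtopeEUB slL15_nodup slL15_deg 16 39 268 (q := 1) (a := 6) (L := 6) (by norm_num) (by norm_num) (by norm_num) (by rw [phatopeEUBs16_eq]; exact cellChk_opeEUB_s16l3) (by norm_num; linarith) (by norm_num; linarith)
      · exact absurd hℓ (by decide)
      · have h1 : (18 : ℝ) ≤ Δ := by exact_mod_cast hℓΔ
        refine ⟨39 + 1, by norm_num, ?_⟩
        rcases le_or_gt Δ (29 : ℝ) with hd0 | hd0
        · exact cell_nonneg_of_bernAuto_trunc wtopeEUB slL15_nodup slL15_deg 18 39 270 (q := 2) (a := 0) (L := 11) (by norm_num) (by norm_num) (by norm_num) (by rw [phatopeEUBs18_eq]; exact cellChk_opeEUB_s18l0) (by norm_num; linarith) (by norm_num; linarith)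
        exact cell_nonneg_of_bernAuto_trunc wtopeEUB slL15_nodup slL15_deg 18 39 270 (q := 2) (a := 11) (L := 11) (by norm_num) (by norm_num) (by norm_num) (by rw [phatopeEUBs18_eq]; exact cellChk_opeEUB_s18l1) (by norm_num; linarith) (by norm_num; linarith)
      · exact absurd hℓ (by decide)
      · have h1 : (20 : ℝ) ≤ Δ := by exact_mod_cast hℓΔ
        refine ⟨39 + 1, by norm_num, ?_⟩
        exact cell_nonneg_of_bernAuto_trunc wtopeEUB slL15_nodup slL15_deg 20 39 272 (q := 1) (a := 0) (L := 10) (by norm_num) (by norm_num) (by norm_num) (by rw [phatopeEUBs20_eq]; exact cellChk_opeEUB_s20l0) (by norm_num; linarith) (by norm_num; linarith)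
      · exact absurd hℓ (by decide)
      · have h1 : (22 : ℝ) ≤ Δ := by exact_mod_cast hℓΔ
        refine ⟨39 + 1, by norm_num, ?_⟩
        exact cell_nonneg_of_bernAuto_trunc wtopeEUB slL15_nodup slL15_deg 22 39 274 (q := 1) (a := 0) (L := 9) (by norm_num) (by norm_num) (by norm_num) (by rw [phatopeEUBs22_eq]; exact cellChk_opeEUB_s22l0) (by norm_num; linarith) (by norm_num; linarith)
      · exact absurd hℓ (by decide)
      · have h1 : (24 : ℝ) ≤ Δ := by exact_mod_cast hℓΔ
        refine ⟨39 + 1, by norm_num, ?_⟩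
        exact cell_nonneg_of_bernAuto_trunc wtopeEUB slL15_nodup slL15_deg 24 39 276 (q := 1) (a := 0) (L := 8) (by norm_num) (by norm_num) (by norm_num) (by rw [phatopeEUBs24_eq]; exact cellChk_opeEUB_s24l0) (by norm_num; linarith) (by norm_num; linarith)
      · exact absurd hℓ (by decide)
      · have h1 : (26 : ℝ) ≤ Δ := by exact_mod_cast hℓΔ
        refine ⟨39 + 1, by norm_num, ?_⟩
        exact cell_nonneg_of_bernAuto_trunc wtopeEUB slL15_nodup slL15_deg 26 39 277 (q := 1) (a := 0) (L := 7) (by norm_num) (by norm_num) (by norm_num) (by rw [phatopeEUBs26_eq]; exact cellChk_opeEUB_s26l0) (by norm_num; linarith) (by norm_num; linarith)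
      · exact absurd hℓ (by decide)
      · have h1 : (28 : ℝ) ≤ Δ := by exact_mod_cast hℓΔ
        refine ⟨39 + 1, by norm_num, ?_⟩
        exact cell_nonneg_of_bernAuto_trunc wtopeEUB slL15_nodup slL15_deg 28 39 279 (q := 1) (a := 0) (L := 6) (by norm_num) (by norm_num) (by norm_num) (by rw [phatopeEUBs28_eq]; exact cellChk_opeEUB_s28l0) (by norm_num; linarith) (by norm_num; linarith)
      · exact absurd hℓ (by decide)
      · have h1 : (30 : ℝ) ≤ Δ := by exact_mod_cast hℓΔ
        refine ⟨39 + 1, by norm_num, ?_⟩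
        exact cell_nonneg_of_bernAuto_trunc wtopeEUB slL15_nodup slL15_deg 30 39 281 (q := 1) (a := 0) (L := 5) (by norm_num) (by norm_num) (by norm_num) (by rw [phatopeEUBs30_eq]; exact cellChk_opeEUB_s30l0) (by norm_num; linarith) (by norm_num; linarith)
      · exact absurd hℓ (by decide)
      · have h1 : (32 : ℝ) ≤ Δ := by exact_mod_cast hℓΔ
        refine ⟨39 + 1, by norm_num, ?_⟩
        exact cell_nonneg_of_bernAuto_trunc wtopeEUB slL15_nodup slL15_deg 32 39 282 (q := 1) (a := 0) (L := 4) (by norm_num) (by norm_num) (by norm_num) (by rw [phatopeEUBs32_eq]; exact cellChk_opeEUB_s32l0) (by norm_num; linarith) (by norm_num; linarith)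
      · exact absurd hℓ (by decide)
      · have h1 : (34 : ℝ) ≤ Δ := by exact_mod_cast hℓΔ
        refine ⟨39 + 1, by norm_num, ?_⟩
        exact cell_nonneg_of_bernAuto_trunc wtopeEUB slL15_nodup slL15_deg 34 39 284 (q := 1) (a := 0) (L := 3) (by norm_num) (by norm_num) (by norm_num) (by rw [phatopeEUBs34_eq]; exact cellChk_opeEUB_s34l0) (by norm_num; linarith) (by norm_num; linarith)
      · exact absurd hℓ (by decide)
      · have h1 : (36 : ℝ) ≤ Δ := by exact_mod_cast hℓΔ
        refine ⟨39 + 1, by norm_num, ?_⟩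
        exact cell_nonneg_of_bernAuto_trunc wtopeEUB slL15_nodup slL15_deg 36 39 285 (q := 1) (a := 0) (L := 2) (by norm_num) (by norm_num) (by norm_num) (by rw [phatopeEUBs36_eq]; exact cellChk_opeEUB_s36l0) (by norm_num; linarith) (by norm_num; linarith)
      · exact absurd hℓ (by decide)
      · have h1 : (38 : ℝ) ≤ Δ := by exact_mod_cast hℓΔ
        refine ⟨39 + 1, by norm_num, ?_⟩
        exact cell_nonneg_of_bernAuto_trunc wtopeEUB slL15_nodup slL15_deg 38 39 286 (q := 1) (a := 0) (L := 1) (by norm_num) (by norm_num) (by norm_num) (by rw [phatopeEUBs38_eq]; exact cellChk_opeEUB_s38l0) (by norm_num; linarith) (by norm_num; linarith)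
      · exact absurd hℓ (by decide)
  have hbox : ∀ Δ : ℝ, (197 / 200 : ℝ) ≤ Δ → Δ ≤ 20001 / 20000 → ∃ N : ℕ, (40 : ℝ) ≤ Δ + N ∧
      0 < taylorFunctional2D (1 / 2) slL15.toFinset (fun p => (wtopeEUB p : ℝ)) (crossF (1 / 8) (-1) (QN N 0 Δ)) ∧
      0 < taylorFunctional2D (1 / 2) slL15.toFinset (fun p => (wtopeEUB p : ℝ)) (crossF (1 / 8) (-1) (fun _ _ => (1 : ℝ))) +
        (((319051 : ℕ) : ℝ) / ((5000000 : ℕ) : ℝ)) * ((2 : ℝ) ^ Δ * taylorFunctional2D (1 / 2) slL15.toFinset (fun p => (wtopeEUB p : ℝ)) (crossF (1 / 8) (-1) (QN N 0 Δ))) := by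
    intro Δ h1 h2
    refine ⟨55 + 1, by norm_num at h1 ⊢; linarith, ?_, ?_⟩
    · exact epsSignUpper_of_bernAuto_trunc wtopeEUB slL15_nodup slL15_deg 55 358 (q := 40000) (a := 19700) (L := 301) (by norm_num) (by norm_num) (by norm_num) (by rw [phatopeEUBs0_eq]; exact epsChkU_opeEUB_l0) (by norm_num; linarith) (by norm_num; linarith)
    · exact epsIdent_of_bernAuto_trunc wtopeEUB slL15_nodup slL15_deg 55 363 (Pn := 319051) (Pd := 5000000) (by norm_num) (q := 40000) (a := 19700) (L := 301) (by norm_num) (by norm_num) (by norm_num) (by unfold epsIdentPolyZ; rw [phatopeEUBs0_eq]; exact epsChkI_opeEUB_l0) (by norm_num; linarith) (by norm_num; linarith)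
  have h := opeEpsUpper_half_of_cellsN slL15.toFinset (fun p => (wtopeEUB p : ℝ)) (s := 1 / 8) (G := 2) (δ := 1) (E₀ := 40)
    (by norm_num) (by norm_num) (by norm_num) (by norm_num) (by norm_num) (by norm_num) hbox
    (region_of_kernelCertAuto wtopeEUB slL15_nodup slL15_deg 15 16 (by norm_num) (by norm_num) PregopeEUB_eq
      (by decide +kernel) QhatopeEUB_eq _ cregopeEUB_n0 cregJopeEUB (by decide) cregJopeEUB_ok) cells_opeEUB
  push_cast at h
  exact h

end Summit.CriticalPhenomena.Ising3D.Control2D
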